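import Summits.Ventures.HodgeKum4.Theorems.KummerFixedLocusTangentDischarged
import Summits.Ventures.HodgeKum4.Theorems.KummerFixedLocusAndreDischarged
import Summits.Ventures.HodgeKum4.Theorems.KummerFixedLocusTranslationGroup
import Summits.Ventures.HodgeKum4.Theorems.KummerFixedLocusL2DominatedHodge
import Summits.Ventures.HodgeKum4.Theorems.KummerFixedLocusLefschetzGenerationKum4OfPrint
import HarnessLib

/-!
# Rung H3 END TO END IN THE TREE: `HC_Kum4Type ∧ HC_Kum4TypePowers` from the nineteen named print facts (cell `hodge-kum4`, seat p2 g13)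

HONEST FRAMING.  Nothing in this file proves the Hodge conjecture, `HC_Kum4Type`, L1 or any printed theorem
outright.  The main theorem `hc_kum4Type_of_print` is CONDITIONAL: its hypotheses are EXACTLY the nineteen named
Literature facts of the cell's print ledger (plan g19 `EndToEnd.md`, rows 1–19; refereed-status grading is the
literature/referee seats' record, not this file's), each an unproved `def … : Prop` transcribing a published
theorem, and its conclusion is the rung `Summit.Ventures.HodgeKum4.HC_Kum4Type` (the Hodge conjecture for every
smooth projective eightfold of `Kum⁴`-type) together with the bonus `HC_Kum4TypePowers` (all powers).  What is
new is only WHERE the composition lives: until now the end-to-end certificate was a scratch file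
(`HOME/plan/g19/EndToEnd.scratch.lean` 86919e20ca1527ca, binders `SF.NumberHalf`/`SF.JoinHalf` still open at the
time); with item stmt-Ventures-20306 (`LefschetzGenerationHilbW 5`) CLOSED and p1's
`LaneV.lefschetzGenerationKum4_of_print` (L1 modulo the eight lane-(V) print facts) landed, the whole chain is a
composition of LANDED tree theorems and is recorded here as one kernel-checked theorem over tree modules only:

  `hc_kum4Type_of_print` = Bill A‴ `hc_kum4Type_of_L1_of_split125'''` (p2 g9, `KummerFixedLocusTangentDischarged`:
  eleven facts + L1 ⟹ H3 ∧ powers) ∘ `LaneV.lefschetzGenerationKum4_of_print` (p1 g5: eight facts ⟹ L1, through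
  `lefschetzGenerationHilbW_all 5` ← `SF.stub_span_of_halves SF.numberHalf SF.joinHalf` ← the V2 stubs, V0
  `hilbertKummerTransfer_of_print'`, the bridge `kummerRangeEqInvariants_of_print`, T₄).

Second form (§2): THE ROUTE'S OWN DECIDING THEOREM `…Theses.KummerFixedLocus.closes` (binders h₁ L1 · h₂ L2 · hΓ F_Γ ·
hoff F_Γ′ · h₃ L3°, items 19134 · 19136 · 19137 · 19138 · 19135) APPLIED TO ITS FIVE BINDERS, EACH DISCHARGED MODULO
PRINT BY NAME — h₁ by `LaneV.lefschetzGenerationKum4_of_print` (facts 1–8), h₂ by `motivicBookkeepingKum4_of_print` below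
(facts 9–11: the registered L2 birth line's direct road, `gammaInvariantsDominatedKum4_of_facts'` + the landed image-form
Arapura lemma `KummerL2Scratch.dominatedHodgeClassesAlgebraic`, independent of L3°), hΓ by `kum4TranslationGroup_of_literature`
(facts 18, 16), hoff by `kum4TranslationGroupTrivialOffMiddle_of_literature` (fact 16), h₃ by
`kum4NonInvariantClassesAlgebraic_of_L1_of_split125'` (facts 12–19 + h₁) — `hc_kum4Type_of_print_closes`.  The two forms
consume the same nineteen facts; §2 is the kernel certificate of «every binder of `closes` is proved modulo print»
(the items stay OPEN BY DESIGN: their own signatures are unconditional); the support items 19503 (F_Γ ∧ L1) and 19160 (L2′)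
are discharged modulo print the same way (`kum4TranslationGroupAndL1_of_print`, `invariantHodgeClassesAlgebraicKum4_of_print`).

Also recorded: the specialisation to the generalized Kummer eightfolds `K⁴(A)` themselves (every abelian surface `A`;
`hodgeConjectureFor_generalizedKummerFour_of_print`, via `IsOfGeneralizedKummerType.of_hodgeModel`).  (Typing remark, not
a declaration: `HC_Kum4Type` is verbatim the summit statement `HodgeConjecture` of `Summits/HodgeConjecture/Statement.lean` —
`∀ n X, IsSmoothProjective n X → HodgeConjectureFor n X` — restricted to `n = 8` and `IsOfGeneralizedKummerType 4 X`.)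

## The print ledger (the binders of `hc_kum4Type_of_print`, in this order; bib keys and locators are those of
the `[cite: …]` tags of the fact declarations themselves — all under `Literature/AlgebraicGeometry/`)

L1 leg (lane (V), `Cruxes/LefschetzGenerationKum4/Lines/laneV.lean` v6 `stub_print`):
 1. `HilbertScheme.LiQinWang2002W_chernCharacter_zeroModes_abelianSurface` (`HilbertScheme/ChernCharacterWZeroModes`)
    — LiQinWang2002W Thm 3.1/4.6, LiQinWang2002 Thm 2.16/4.10/5.13, Lehn1999 Thm 3.10;
 2. `Hyperkaehler.Beauville1983_irreducibleSymplectic_of_kummerType` (`Hyperkaehler/IrreducibleSymplecticOfDeformationType`)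
    — Beauville1983 §7 Thm 4, Prop 7–8, §8 Prop 9;
 3. `Hyperkaehler.LooijengaLuntsVerbitsky_llvStructure_kumType` (`Hyperkaehler/LLVStructureKummerType`)
    — LooijengaLunts1997 (4.5), (4.7); GreenKimLazaRobles2022 Thm 14;
 4. `Hyperkaehler.HassettTschinkel2013_autZero_cohomologyTransport_kumType` (T₄; `Hyperkaehler/GeneralizedKummerTypeCohomologyTransport`)
    — HassettTschinkel2013 Thm 2.1 (with Kodaira2005, VoisinHodgeI2002 §9, SerreGAGA1956, Oguiso2020 §4);
 5. `HilbertScheme.Fogarty1968_hilbertScheme_surface` (`HilbertScheme/HilbertSchemeOfPointsExists`)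
    — Fogarty1968 Thm 2.4; GrothendieckFGA exp. 221; Nitsure2005 Thm 5.1;
 6. `HilbertScheme.Beauville1983_kummerCover_galois` (`HilbertScheme/HilbertSchemeTranslationAction`)
    — Beauville1983 §7 p. 769 fn 2; KapferMenet2018 Lemma 5.4;
 7. `Hyperkaehler.Verbitsky1996_hasDualLefschetz_of_topPower_ne_zero` (`Hyperkaehler/LefschetzClassesIrreducibleSymplectic`)
    — Verbitsky1995/1996, LooijengaLunts1997 §1–§4, Fujiki1987 Thm 4.7, GrossHuybrechtsJoyce2003 Prop 23.14/24.6;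
 8. `Hyperkaehler.BNWS2011_autFixingH2H3_generalizedKummer` (`Hyperkaehler/GeneralizedKummerAutFixingH2H3`)
    — BoissiereNieperWisskirchenSarti2011 §3.1, Cor 3.3; Oguiso2020 Thm 1.2, Lemma 3.4; Foster2024 Lemma 85.
Bill A‴ (fixed-locus branch L3°, bookkeeping L2, `Γ`-structure):
 9. `Hyperkaehler.OGradyVoisin2022_thirdJacobian_kugaSatake_kummerType` (`Hyperkaehler/KummerTypeIntermediateJacobian`)
    — OGrady2021KummerTori Thm 1.1/1.5; Voisin2022FootnotesOGradyMarkman Thm 4.1; Markman2023GeneralizedKummers Thm 1.4;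
10. `HodgeTheory.FloccariFu2026_hodgeClasses_algebraic_powers_discOneWeilFourfold` (`HodgeTheory/WeilFourfoldsDiscOnePowers`)
    — FloccariFu2026 Thm 1.2;
11. `Hyperkaehler.Foster2024_lefschetzStandard_kummerType_prime` (`Hyperkaehler/GeneralizedKummerTypeLefschetzStandard`)
    — Foster2024 Cor 2 of Thm 1 (= Thm 86); Andre1996Motifs Prop 1.2;
12. `HodgeTheory.Hirzebruch1969_gSignature_involution_halfDimFixedLocus` (`HodgeTheory/HolomorphicInvolutionGSignature`)
    — Hirzebruch1969SignatureRamifiedCoverings (1), (3), (6); JaenichOssa1969 Eq. (1);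
13. `Hyperkaehler.Floccari2026_fixedFourfold_kum4Type` (`Hyperkaehler/GeneralizedKummerTypeFixedFourfold`)
    — Floccari2026 Lemma 4.2, Prop 4.6; Floccari2023 §2.5;
14. `Hyperkaehler.GoettscheSoergel1993_chiY_kum4Type` (`Hyperkaehler/GeneralizedKummerFourHodgeNumbers`)
    — GoettscheSoergel1993 (χ_y of Kumₙ, as displayed in OberdieckSongVoisin2022 §5); GreenKimLazaRobles2022 Cor 35;
15. `Hyperkaehler.GreenKimLazaRobles2022_llvTrivial_isOfHodgeType_kumType` (`Hyperkaehler/LLVTrivialClassesHodgeType`)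
    — GreenKimLazaRobles2022 Prop 21; KurnosovSoldatenkovVerbitsky2019 §1, §5.2; Verbitsky1990SO5;
16. `Hyperkaehler.Foster2024_translationAction_kum4Type` (`Hyperkaehler/GeneralizedKummerTypeTranslationGroup`)
    — Foster2024 Lemma 85, Example 3, Prop 87, Remark 88; Floccari2026 §4.4;
17. `HodgeTheory.Fulton1998_cupPairing_transversalPoint` (`HodgeTheory/TransversalPointIntersectionNumber`)
    — Fulton1998 Prop 8.2, Rem 8.2, §19.1, Cor 19.2; FultonYoungTableaux1997 App. B (4), (9);
18. `Hyperkaehler.FloccariVaresco2024_autFixingH2H3_equiv_kumType` (`Hyperkaehler/GeneralizedKummerTypeTranslationGroup`)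
    — FloccariVaresco2024 §3 ¶1; BoissiereNieperWisskirchenSarti2011; HassettTschinkel2010 Thm 2.1;
19. `Hyperkaehler.HassettTschinkel2013_Oguiso2020_fixedPointScheme_translation_kum4Type` (F125X;
    `Hyperkaehler/GeneralizedKummerTypeTranslationFixedPoints`) — HassettTschinkel2013 Thm 2.1; Oguiso2020 Prop 3.5–3.6;
    ConradGabberPrasad2015 Prop A.8.10(2); Floccari2024 Lemma 2.2 (print synthesis).

NOT binders (discharged in the tree earlier): André 1996 Prop 1.2 (guarded dual Lefschetz), the Hodge-index
inputs, Milne's tangent-dimension fact (`…_holds`), Beauville's translation action (`…_holds`).  Route items left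
OPEN BY DESIGN (their signatures are unconditional; director-hodge g8 14:14:32Z): 19134/19136 (`stub_print`), 19135
(glue modulo print), 19137/19138 (print leaves) — this file does not close any of them and does not restate them.
-/

noncomputable section

open Literature.AlgebraicGeometry Literature.AlgebraicGeometry.Motives
open Literature.AlgebraicGeometry.Hyperkaehler Literature.AlgebraicGeometry.HilbertScheme
open Literature.AlgebraicGeometry.HodgeTheory

namespace Summit.Ventures.HodgeKum4

/-! ### §1 H3 end to end, modulo the print ledger (Bill A‴ ∘ lane (V)) -/

/-- **RUNG H3 MODULO PRINT, END TO END IN THE TREE: the nineteen named print facts ⟹ `HC_Kum4Type ∧ HC_Kum4TypePowers`.**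
Binders 1–8 = the lane-(V) print bundle (L1 leg), binders 9–19 = the eleven facts of Bill A‴ (module docstring for
the row-by-row ledger with sources).  Proof = Bill A‴ `hc_kum4Type_of_L1_of_split125'''` applied to p1's
`LaneV.lefschetzGenerationKum4_of_print` (L1 `…Theses.KummerFixedLocus.LefschetzGenerationKum4` from binders 1–8,
itself resting on the CLOSED item `LefschetzGenerationHilbW 5`, V0, the bridge and T₄).  CONDITIONAL on all
nineteen; every binder is an unproved transcription of a published theorem; nothing is proved outright. -/
theorem hc_kum4Type_of_print
    -- L1 leg (lane (V) print bundle)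
    (hLQW : LiQinWang2002W_chernCharacter_zeroModes_abelianSurface)
    (hBe : Beauville1983_irreducibleSymplectic_of_kummerType)
    (hLLV : LooijengaLuntsVerbitsky_llvStructure_kumType)
    (hT4 : HassettTschinkel2013_autZero_cohomologyTransport_kumType)
    (hGF : Fogarty1968_hilbertScheme_surface)
    (hGal : Beauville1983_kummerCover_galois)
    (hVe : Verbitsky1996_hasDualLefschetz_of_topPower_ne_zero)
    (hBNWS : BNWS2011_autFixingH2H3_generalizedKummer)
    -- Bill A‴
    (hOGV : OGradyVoisin2022_thirdJacobian_kugaSatake_kummerType)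
    (hFF : FloccariFu2026_hodgeClasses_algebraic_powers_discOneWeilFourfold)
    (hFo : Foster2024_lefschetzStandard_kummerType_prime)
    (hHi : Hirzebruch1969_gSignature_involution_halfDimFixedLocus)
    (hFl : Floccari2026_fixedFourfold_kum4Type)
    (hGS : GoettscheSoergel1993_chiY_kum4Type)
    (hGK : GreenKimLazaRobles2022_llvTrivial_isOfHodgeType_kumType)
    (hFT : Foster2024_translationAction_kum4Type)
    (hFu : Fulton1998_cupPairing_transversalPoint)
    (hFV : FloccariVaresco2024_autFixingH2H3_equiv_kumType)
    (h125 : HassettTschinkel2013_Oguiso2020_fixedPointScheme_translation_kum4Type) :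
    HC_Kum4Type ∧ HC_Kum4TypePowers :=
  hc_kum4Type_of_L1_of_split125''' hOGV hFF hFo hHi hFl hGS hGK hFT hFu hFV h125
    (LaneV.lefschetzGenerationKum4_of_print hLQW hBe hLLV hT4 hGF hGal hVe hBNWS)

/-- **H3 for `Kum⁴`-type modulo print** (first conjunct of `hc_kum4Type_of_print`): the nineteen named print facts
⟹ the Hodge conjecture for every smooth projective eightfold of `Kum⁴`-type.  CONDITIONAL on all nineteen. -/
theorem hc_kum4Type_of_print'
    (hLQW : LiQinWang2002W_chernCharacter_zeroModes_abelianSurface)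
    (hBe : Beauville1983_irreducibleSymplectic_of_kummerType)
    (hLLV : LooijengaLuntsVerbitsky_llvStructure_kumType)
    (hT4 : HassettTschinkel2013_autZero_cohomologyTransport_kumType)
    (hGF : Fogarty1968_hilbertScheme_surface)
    (hGal : Beauville1983_kummerCover_galois)
    (hVe : Verbitsky1996_hasDualLefschetz_of_topPower_ne_zero)
    (hBNWS : BNWS2011_autFixingH2H3_generalizedKummer)
    (hOGV : OGradyVoisin2022_thirdJacobian_kugaSatake_kummerType)
    (hFF : FloccariFu2026_hodgeClasses_algebraic_powers_discOneWeilFourfold)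
    (hFo : Foster2024_lefschetzStandard_kummerType_prime)
    (hHi : Hirzebruch1969_gSignature_involution_halfDimFixedLocus)
    (hFl : Floccari2026_fixedFourfold_kum4Type)
    (hGS : GoettscheSoergel1993_chiY_kum4Type)
    (hGK : GreenKimLazaRobles2022_llvTrivial_isOfHodgeType_kumType)
    (hFT : Foster2024_translationAction_kum4Type)
    (hFu : Fulton1998_cupPairing_transversalPoint)
    (hFV : FloccariVaresco2024_autFixingH2H3_equiv_kumType)
    (h125 : HassettTschinkel2013_Oguiso2020_fixedPointScheme_translation_kum4Type) :
    HC_Kum4Type :=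
  (hc_kum4Type_of_print hLQW hBe hLLV hT4 hGF hGal hVe hBNWS hOGV hFF hFo hHi hFl hGS hGK hFT hFu hFV h125).1

/-- **HC for all powers of every smooth projective `Kum⁴`-type `X` modulo print** (second conjunct of
`hc_kum4Type_of_print`).  CONDITIONAL on all nineteen named print facts. -/
theorem hc_kum4TypePowers_of_print
    (hLQW : LiQinWang2002W_chernCharacter_zeroModes_abelianSurface)
    (hBe : Beauville1983_irreducibleSymplectic_of_kummerType)
    (hLLV : LooijengaLuntsVerbitsky_llvStructure_kumType)
    (hT4 : HassettTschinkel2013_autZero_cohomologyTransport_kumType)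
    (hGF : Fogarty1968_hilbertScheme_surface)
    (hGal : Beauville1983_kummerCover_galois)
    (hVe : Verbitsky1996_hasDualLefschetz_of_topPower_ne_zero)
    (hBNWS : BNWS2011_autFixingH2H3_generalizedKummer)
    (hOGV : OGradyVoisin2022_thirdJacobian_kugaSatake_kummerType)
    (hFF : FloccariFu2026_hodgeClasses_algebraic_powers_discOneWeilFourfold)
    (hFo : Foster2024_lefschetzStandard_kummerType_prime)
    (hHi : Hirzebruch1969_gSignature_involution_halfDimFixedLocus)
    (hFl : Floccari2026_fixedFourfold_kum4Type)
    (hGS : GoettscheSoergel1993_chiY_kum4Type)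
    (hGK : GreenKimLazaRobles2022_llvTrivial_isOfHodgeType_kumType)
    (hFT : Foster2024_translationAction_kum4Type)
    (hFu : Fulton1998_cupPairing_transversalPoint)
    (hFV : FloccariVaresco2024_autFixingH2H3_equiv_kumType)
    (h125 : HassettTschinkel2013_Oguiso2020_fixedPointScheme_translation_kum4Type) :
    HC_Kum4TypePowers :=
  (hc_kum4Type_of_print hLQW hBe hLLV hT4 hGF hGal hVe hBNWS hOGV hFF hFo hHi hFl hGS hGK hFT hFu hFV h125).2

/-- **HC for the generalized Kummer eightfolds `K⁴(A)` themselves, modulo print**: for every abelian surface `A` and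
every generalized Kummer variety `K = K⁴(A)` (smooth projective of dimension `8`), `HodgeConjectureFor 8 K` — the rung
specialised along `IsOfGeneralizedKummerType.of_hodgeModel` (a Hodge model exists by the tree theorem
`nonempty_hodgeModel_holds`).  CONDITIONAL on the nineteen named print facts. -/
theorem hodgeConjectureFor_generalizedKummerFour_of_print
    (hLQW : LiQinWang2002W_chernCharacter_zeroModes_abelianSurface)
    (hBe : Beauville1983_irreducibleSymplectic_of_kummerType)
    (hLLV : LooijengaLuntsVerbitsky_llvStructure_kumType)
    (hT4 : HassettTschinkel2013_autZero_cohomologyTransport_kumType)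
    (hGF : Fogarty1968_hilbertScheme_surface)
    (hGal : Beauville1983_kummerCover_galois)
    (hVe : Verbitsky1996_hasDualLefschetz_of_topPower_ne_zero)
    (hBNWS : BNWS2011_autFixingH2H3_generalizedKummer)
    (hOGV : OGradyVoisin2022_thirdJacobian_kugaSatake_kummerType)
    (hFF : FloccariFu2026_hodgeClasses_algebraic_powers_discOneWeilFourfold)
    (hFo : Foster2024_lefschetzStandard_kummerType_prime)
    (hHi : Hirzebruch1969_gSignature_involution_halfDimFixedLocus)
    (hFl : Floccari2026_fixedFourfold_kum4Type)
    (hGS : GoettscheSoergel1993_chiY_kum4Type)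
    (hGK : GreenKimLazaRobles2022_llvTrivial_isOfHodgeType_kumType)
    (hFT : Foster2024_translationAction_kum4Type)
    (hFu : Fulton1998_cupPairing_transversalPoint)
    (hFV : FloccariVaresco2024_autFixingH2H3_equiv_kumType)
    (h125 : HassettTschinkel2013_Oguiso2020_fixedPointScheme_translation_kum4Type)
    ⦃A : AbelianVariety ℂ⦄ ⦃K : Motives.SchemeOver ℂ⦄ (hA : A.dim = 2) (hK : IsGeneralizedKummerVarietyOf 4 A K)
    (hKs : Motives.IsSmoothProjective 8 K) : HodgeConjectureFor 8 K := by
  obtain ⟨M⟩ := nonempty_hodgeModel_holds (n := 2 * 4) hKs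
  exact hc_kum4Type_of_print' hLQW hBe hLLV hT4 hGF hGal hVe hBNWS hOGV hFF hFo hHi hFl hGS hGK hFT hFu hFV h125 hKs
    (IsOfGeneralizedKummerType.of_hodgeModel hA hK hKs M)

/-- **The same with the print ledger as ONE conjunction** (the two registered `stub_print` bundles side by side:
lane (V)'s eight facts, then Bill A‴'s eleven): `PRINT ⟹ HC_Kum4Type ∧ HC_Kum4TypePowers`.  CONDITIONAL. -/
theorem hc_kum4Type_of_printLedger
    (hP : (LiQinWang2002W_chernCharacter_zeroModes_abelianSurface ∧ Beauville1983_irreducibleSymplectic_of_kummerType ∧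
        LooijengaLuntsVerbitsky_llvStructure_kumType ∧ HassettTschinkel2013_autZero_cohomologyTransport_kumType ∧
        Fogarty1968_hilbertScheme_surface ∧ Beauville1983_kummerCover_galois ∧
        Verbitsky1996_hasDualLefschetz_of_topPower_ne_zero ∧ BNWS2011_autFixingH2H3_generalizedKummer) ∧
      (OGradyVoisin2022_thirdJacobian_kugaSatake_kummerType ∧
        FloccariFu2026_hodgeClasses_algebraic_powers_discOneWeilFourfold ∧
        Foster2024_lefschetzStandard_kummerType_prime ∧ Hirzebruch1969_gSignature_involution_halfDimFixedLocus ∧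
        Floccari2026_fixedFourfold_kum4Type ∧ GoettscheSoergel1993_chiY_kum4Type ∧
        GreenKimLazaRobles2022_llvTrivial_isOfHodgeType_kumType ∧ Foster2024_translationAction_kum4Type ∧
        Fulton1998_cupPairing_transversalPoint ∧ FloccariVaresco2024_autFixingH2H3_equiv_kumType ∧
        HassettTschinkel2013_Oguiso2020_fixedPointScheme_translation_kum4Type)) :
    HC_Kum4Type ∧ HC_Kum4TypePowers :=
  have hV := hP.1
  have hA := hP.2
  hc_kum4Type_of_print hV.1 hV.2.1 hV.2.2.1 hV.2.2.2.1 hV.2.2.2.2.1 hV.2.2.2.2.2.1 hV.2.2.2.2.2.2.1 hV.2.2.2.2.2.2.2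
    hA.1 hA.2.1 hA.2.2.1 hA.2.2.2.1 hA.2.2.2.2.1 hA.2.2.2.2.2.1 hA.2.2.2.2.2.2.1 hA.2.2.2.2.2.2.2.1 hA.2.2.2.2.2.2.2.2.1
    hA.2.2.2.2.2.2.2.2.2.1 hA.2.2.2.2.2.2.2.2.2.2

/-! ### §2 The route's deciding theorem `closes` applied to its five binders, each discharged modulo print -/

/-- **h₂ — L2 `MotivicBookkeepingKum4` (item stmt-Ventures-19136, route decl BY NAME) modulo its THREE print facts**
(O'Grady–Markman–Voisin `J³`, Floccari–Fu, Foster `B(X)`): the registered birth line's direct road — p2's landed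
`gammaInvariantsDominatedKum4_of_facts'` (L1 + the three facts ⟹ the `Γ`-invariants are dominated by the powers of
`T = J³(X)`, HC on those powers) followed by the landed image-form Arapura lemma
`KummerL2Scratch.dominatedHodgeClassesAlgebraic` (p535613).  Independent of L3°; André's input is a tree theorem.
CONDITIONAL on the three facts (L2 is itself the implication `L1 → invariants algebraic`). -/
theorem motivicBookkeepingKum4_of_print
    (hOGV : OGradyVoisin2022_thirdJacobian_kugaSatake_kummerType)
    (hFF : FloccariFu2026_hodgeClasses_algebraic_powers_discOneWeilFourfold)
    (hFo : Foster2024_lefschetzStandard_kummerType_prime) :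
    Summit.Ventures.HodgeKum4.Theses.KummerFixedLocus.MotivicBookkeepingKum4 := by
  unfold Summit.Ventures.HodgeKum4.Theses.KummerFixedLocus.MotivicBookkeepingKum4
  intro h1 X hX hK p c hrat hpp hinv
  obtain ⟨B, hB, hHC, hdom⟩ := gammaInvariantsDominatedKum4_of_facts' hOGV hFF hFo h1 hX hK
  exact Summit.HodgeConjecture.CorCM.Stage4.KummerL2Scratch.dominatedHodgeClassesAlgebraic hB hX hHC p c hrat hpp
    (hdom (2 * p) c hinv)

/-- **hΓ — F_Γ `Kum4TranslationGroup` (item stmt-Ventures-19137, route decl BY NAME) modulo print**: `|Γ(X)| = 625`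
from `Γ(X) ≅ (ℤ/5)⁴` (fact 18, `FloccariVaresco2024….floccari2026_card`) and `dim 𝒦 ≤ 624` (fact 16), via the landed
transcription `kum4TranslationGroup_of_literature`.  CONDITIONAL on the two facts. -/
theorem kum4TranslationGroup_of_print (hFV : FloccariVaresco2024_autFixingH2H3_equiv_kumType)
    (hFT : Foster2024_translationAction_kum4Type) :
    Summit.Ventures.HodgeKum4.Theses.KummerFixedLocus.Kum4TranslationGroup :=
  kum4TranslationGroup_of_literature (FloccariVaresco2024_autFixingH2H3_equiv_kumType.floccari2026_card hFV) hFT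

/-- **hoff — F_Γ′ `Kum4TranslationGroupTrivialOffMiddle` (item stmt-Ventures-19138, route decl BY NAME) modulo print**:
clause (ii) of Foster's fact 16, via the landed transcription `kum4TranslationGroupTrivialOffMiddle_of_literature`.
CONDITIONAL on the fact. -/
theorem kum4TranslationGroupTrivialOffMiddle_of_print (hFT : Foster2024_translationAction_kum4Type) :
    Summit.Ventures.HodgeKum4.Theses.KummerFixedLocus.Kum4TranslationGroupTrivialOffMiddle :=
  kum4TranslationGroupTrivialOffMiddle_of_literature hFT

/-- **h₃ — L3° `Kum4NonInvariantClassesAlgebraic` (item stmt-Ventures-19135, route decl BY NAME) modulo print**: p2's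
`kum4NonInvariantClassesAlgebraic_of_L1_of_split125'` (facts 12–19 + L1) with L1 supplied by p1's
`LaneV.lefschetzGenerationKum4_of_print` (facts 1–8).  CONDITIONAL on the sixteen facts named. -/
theorem kum4NonInvariantClassesAlgebraic_of_print
    (hLQW : LiQinWang2002W_chernCharacter_zeroModes_abelianSurface)
    (hBe : Beauville1983_irreducibleSymplectic_of_kummerType)
    (hLLV : LooijengaLuntsVerbitsky_llvStructure_kumType)
    (hT4 : HassettTschinkel2013_autZero_cohomologyTransport_kumType)
    (hGF : Fogarty1968_hilbertScheme_surface)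
    (hGal : Beauville1983_kummerCover_galois)
    (hVe : Verbitsky1996_hasDualLefschetz_of_topPower_ne_zero)
    (hBNWS : BNWS2011_autFixingH2H3_generalizedKummer)
    (hHi : Hirzebruch1969_gSignature_involution_halfDimFixedLocus)
    (hFl : Floccari2026_fixedFourfold_kum4Type)
    (hGS : GoettscheSoergel1993_chiY_kum4Type)
    (hGK : GreenKimLazaRobles2022_llvTrivial_isOfHodgeType_kumType)
    (hFT : Foster2024_translationAction_kum4Type)
    (hFu : Fulton1998_cupPairing_transversalPoint)
    (hFV : FloccariVaresco2024_autFixingH2H3_equiv_kumType)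
    (h125 : HassettTschinkel2013_Oguiso2020_fixedPointScheme_translation_kum4Type) :
    Summit.Ventures.HodgeKum4.Theses.KummerFixedLocus.Kum4NonInvariantClassesAlgebraic :=
  kum4NonInvariantClassesAlgebraic_of_L1_of_split125' hHi hFl hGS hGK hFT hFu hFV h125
    (LaneV.lefschetzGenerationKum4_of_print hLQW hBe hLLV hT4 hGF hGal hVe hBNWS)

/-- **Support item stmt-Ventures-19503 `Kum4TranslationGroupAndL1` (= F_Γ ∧ L1, route decl BY NAME) modulo print** — the
bookkeeping conjunction ⟨hΓ, h₁⟩ of the two discharges above (facts 18, 16 and 1–8).  CONDITIONAL. -/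
theorem kum4TranslationGroupAndL1_of_print
    (hLQW : LiQinWang2002W_chernCharacter_zeroModes_abelianSurface)
    (hBe : Beauville1983_irreducibleSymplectic_of_kummerType)
    (hLLV : LooijengaLuntsVerbitsky_llvStructure_kumType)
    (hT4 : HassettTschinkel2013_autZero_cohomologyTransport_kumType)
    (hGF : Fogarty1968_hilbertScheme_surface)
    (hGal : Beauville1983_kummerCover_galois)
    (hVe : Verbitsky1996_hasDualLefschetz_of_topPower_ne_zero)
    (hBNWS : BNWS2011_autFixingH2H3_generalizedKummer)
    (hFV : FloccariVaresco2024_autFixingH2H3_equiv_kumType) (hFT : Foster2024_translationAction_kum4Type) :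
    Summit.Ventures.HodgeKum4.Theses.KummerFixedLocus.Kum4TranslationGroupAndL1 := by
  unfold Summit.Ventures.HodgeKum4.Theses.KummerFixedLocus.Kum4TranslationGroupAndL1
  exact ⟨kum4TranslationGroup_of_print hFV hFT, LaneV.lefschetzGenerationKum4_of_print hLQW hBe hLLV hT4 hGF hGal hVe hBNWS⟩

/-- **Support item stmt-Ventures-19160 `InvariantHodgeClassesAlgebraicKum4` (L2′, route decl BY NAME) modulo print** — modus
ponens of L2 modulo print (facts 9–11) with L1 modulo print (facts 1–8): every `Γ(X)`-invariant rational `(p,p)`-class of a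
smooth projective `Kum⁴`-type `X` is algebraic, CONDITIONALLY on the eleven facts named. -/
theorem invariantHodgeClassesAlgebraicKum4_of_print
    (hLQW : LiQinWang2002W_chernCharacter_zeroModes_abelianSurface)
    (hBe : Beauville1983_irreducibleSymplectic_of_kummerType)
    (hLLV : LooijengaLuntsVerbitsky_llvStructure_kumType)
    (hT4 : HassettTschinkel2013_autZero_cohomologyTransport_kumType)
    (hGF : Fogarty1968_hilbertScheme_surface)
    (hGal : Beauville1983_kummerCover_galois)
    (hVe : Verbitsky1996_hasDualLefschetz_of_topPower_ne_zero)
    (hBNWS : BNWS2011_autFixingH2H3_generalizedKummer)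
    (hOGV : OGradyVoisin2022_thirdJacobian_kugaSatake_kummerType)
    (hFF : FloccariFu2026_hodgeClasses_algebraic_powers_discOneWeilFourfold)
    (hFo : Foster2024_lefschetzStandard_kummerType_prime) :
    Summit.Ventures.HodgeKum4.Theses.KummerFixedLocus.InvariantHodgeClassesAlgebraicKum4 := by
  unfold Summit.Ventures.HodgeKum4.Theses.KummerFixedLocus.InvariantHodgeClassesAlgebraicKum4
  exact motivicBookkeepingKum4_of_print hOGV hFF hFo
    (LaneV.lefschetzGenerationKum4_of_print hLQW hBe hLLV hT4 hGF hGal hVe hBNWS)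

/-- **RUNG H3 MODULO PRINT THROUGH THE ROUTE'S DECIDING THEOREM**: `…Theses.KummerFixedLocus.closes h₁ h₂ hΓ hoff h₃`
with every binder discharged modulo print by name (h₁ facts 1–8 · h₂ facts 9–11 · hΓ facts 18, 16 · hoff fact 16 ·
h₃ facts 12–19 + h₁) ⟹ `HC_Kum4Type`.  Same nineteen facts as `hc_kum4Type_of_print`; CONDITIONAL on all of them;
no route item is closed by this (their signatures are unconditional). -/
theorem hc_kum4Type_of_print_closes
    (hLQW : LiQinWang2002W_chernCharacter_zeroModes_abelianSurface)
    (hBe : Beauville1983_irreducibleSymplectic_of_kummerType)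
    (hLLV : LooijengaLuntsVerbitsky_llvStructure_kumType)
    (hT4 : HassettTschinkel2013_autZero_cohomologyTransport_kumType)
    (hGF : Fogarty1968_hilbertScheme_surface)
    (hGal : Beauville1983_kummerCover_galois)
    (hVe : Verbitsky1996_hasDualLefschetz_of_topPower_ne_zero)
    (hBNWS : BNWS2011_autFixingH2H3_generalizedKummer)
    (hOGV : OGradyVoisin2022_thirdJacobian_kugaSatake_kummerType)
    (hFF : FloccariFu2026_hodgeClasses_algebraic_powers_discOneWeilFourfold)
    (hFo : Foster2024_lefschetzStandard_kummerType_prime)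
    (hHi : Hirzebruch1969_gSignature_involution_halfDimFixedLocus)
    (hFl : Floccari2026_fixedFourfold_kum4Type)
    (hGS : GoettscheSoergel1993_chiY_kum4Type)
    (hGK : GreenKimLazaRobles2022_llvTrivial_isOfHodgeType_kumType)
    (hFT : Foster2024_translationAction_kum4Type)
    (hFu : Fulton1998_cupPairing_transversalPoint)
    (hFV : FloccariVaresco2024_autFixingH2H3_equiv_kumType)
    (h125 : HassettTschinkel2013_Oguiso2020_fixedPointScheme_translation_kum4Type) :
    HC_Kum4Type :=
  Summit.Ventures.HodgeKum4.Theses.KummerFixedLocus.closes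
    (LaneV.lefschetzGenerationKum4_of_print hLQW hBe hLLV hT4 hGF hGal hVe hBNWS)
    (motivicBookkeepingKum4_of_print hOGV hFF hFo)
    (kum4TranslationGroup_of_print hFV hFT)
    (kum4TranslationGroupTrivialOffMiddle_of_print hFT)
    (kum4NonInvariantClassesAlgebraic_of_print hLQW hBe hLLV hT4 hGF hGal hVe hBNWS hHi hFl hGS hGK hFT hFu hFV h125)

end Summit.Ventures.HodgeKum4

end
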